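import Literature.NumberTheory.LFunctions.MertensConstant
import Literature.NumberTheory.LFunctions.MertensFirstVonMangoldtUpper
import Mathlib.NumberTheory.AbelSummation
import Mathlib.NumberTheory.Harmonic.Bounds
import Mathlib.NumberTheory.ArithmeticFunction.VonMangoldt
import HarnessLib

/-!
# Resonator sums for the Montgomery–Odlyzko gap method: the RH-free asymptotic inputs

Elementary, RH-free estimates with `O(1)` errors that turn the Montgomery–Odlyzko functional
`h(c)` of a resonator `a(n) = ε(n)·w(log n/log y)/√n` (`ε = λ` the Liouville function for small
gaps, `ε = 1` for large gaps [cite: MontgomeryOdlyzko1984, main theorem as quoted in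
BuiMilinovichNg2010 §2 p. 3]) into its limit functional. Everything here is a THEOREM (no
definition, no named fact); the consumer is the discharge of the record
`Literature.NumberTheory.LFunctions.montgomeryOdlyzko1984_smallGaps` (RH ⇒ `μ < 0.5179`) in
`ZetaGapRecordsMO84Proofs.lean`, through the kernel criterion
`Literature.NumberTheory.LFunctions.montgomeryOdlyzko1984_criterion_of_margin`.

Contents (namespace `Literature.NumberTheory.LFunctions.MO84`; Apostol's chapter 3–4 toolkit
[cite: Apostol1976, Thm 3.2(a), Thm 4.2, Thm 4.10] made explicit with the tree's constants):
* §1 ONE abstract partial-summation lemma, `abs_sum_log_pow_mul_sub_le`: if `c 0 = 0` and the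
  counting function `S(t) = Σ_{k ≤ t} c k` satisfies `|S(t) − log t| ≤ B` for `t ≥ 1`, then
  `|Σ_{k ≤ x} (log k)^j c k − (log x)^{j+1}/(j+1)| ≤ 2B (log x)^j` for every `j` and `x ≥ 1`
  (Abel's identity, Apostol Thm 4.2 = Mathlib `sum_mul_eq_sub_integral_mul₀`, with `f = log^j`);
* §2 its two instances: (A1) `c k = 1/k` (`B = 1`, Apostol Thm 3.2(a) in the explicit form of
  Mathlib's harmonic bounds) — `abs_sum_log_pow_div_sub_le` (the plain harmonic bound is the
  tree's `Literature.NumberTheory.Sieve.sum_Icc_one_div_le_one_add_log`); (A2) `c p = log p/p` on primes (`B = 4`: Apostol Thm 4.10 =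
  Mertens I in the explicit form of the tree's `Mertens.abs_mertensTau_le`) —
  `abs_sum_primesLE_logDiv_mul_pow_sub_le`, UNIFORM in `j` after normalising by `(log y)^j`:
  `|Σ_{p ≤ y}(log p/p)(log p/log y)^j − log y/(j+1)| ≤ 8`;
* §3 (A3) the prime-power tail `Σ_{k ≤ x, k ∉ ℙ} Λ(k)/k ≤ 39/50 + 4` (the convergent double sum
  in Apostol's proof of Thm 4.10), as the DIFFERENCE of the tree's
  `MertensFirstUpper.sum_vonMangoldt_div_floor_le_log_add` and
  `MertensBound.sum_log_div_prime_bounds` (no convergence argument).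

WHAT THIS IS NOT: nothing here mentions `ζ`, RH or zeros; no Mertens-2 rate is used or proved.
The plan follows the banked dossier of seat rh-crit-ah-t4 g7
(`pub/rh-crit/ah/rh-crit-ah-t4/MO84-MU-DOSSIER.md`, sha16 01149b77908f51ba), inputs (A1)–(A3);
its (A4) (the `sin` Taylor sign kernel) lives with the consumer.
-/

noncomputable section

open MeasureTheory Set Finset Real

open scoped ArithmeticFunction.vonMangoldt

namespace Literature.NumberTheory.LFunctions

namespace MO84

/-! ### §1. Log-moments of a log-like counting function (one abstract Abel lemma) -/

/-- Calculus: `d/dt (log t)^j = j (log t)^{j-1} t⁻¹` for `t ≠ 0` (all `j : ℕ`, with `ℕ`-subtraction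
in the exponent; for `j = 0` both sides vanish). [folklore] -/
private theorem hasDerivAt_log_pow (j : ℕ) {t : ℝ} (ht : t ≠ 0) :
    HasDerivAt (fun u : ℝ => Real.log u ^ j) ((j : ℝ) * Real.log t ^ (j - 1) * t⁻¹) t :=
  (Real.hasDerivAt_log ht).fun_pow j

/-- Calculus: `d/dt (j/(j+1))(log t)^{j+1} = j (log t)^{j-1} t⁻¹ · log t` for `t ≠ 0`. [folklore] -/
private theorem hasDerivAt_log_pow_succ (j : ℕ) {t : ℝ} (ht : t ≠ 0) :
    HasDerivAt (fun u : ℝ => (j : ℝ) / (j + 1) * Real.log u ^ (j + 1))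
      ((j : ℝ) * Real.log t ^ (j - 1) * t⁻¹ * Real.log t) t := by
  have h := ((Real.hasDerivAt_log ht).fun_pow (j + 1)).const_mul ((j : ℝ) / (j + 1))
  refine h.congr_deriv ?_
  have hj : ((j : ℝ) + 1) ≠ 0 := by positivity
  rcases Nat.eq_zero_or_pos j with rfl | hj0
  · simp
  · obtain ⟨i, rfl⟩ := Nat.exists_eq_add_of_le' hj0
    simp only [Nat.add_sub_cancel, pow_succ]
    push_cast
    field_simp

/-- **Log-moments of a log-like counting function.** If the counting function
`S(t) = Σ_{k ≤ t} c_k` of a sequence with `c_0 = 0` satisfies `|S(t) − log t| ≤ B` for `t ≥ 1`,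
then for every `j : ℕ` and `x ≥ 1`,
`|Σ_{k ≤ x} (log k)^j c_k − (log x)^{j+1}/(j+1)| ≤ 2B (log x)^j`.
Proof: Abel summation (Mathlib `sum_mul_eq_sub_integral_mul₀`, `f = log^j`):
`Σ = S(x)(log x)^j − ∫_1^x j(log t)^{j−1}t⁻¹ S(t) dt`, then `S = log + O(B)` in both terms and
`∫_1^x j (log t)^j t⁻¹ dt = (j/(j+1))(log x)^{j+1}`, `∫_1^x j(log t)^{j−1}t⁻¹ dt ≤ (log x)^j`.
[cite: Apostol1976, Thm 4.2 (Abel's identity), applied with f(t) = (log t)^j] -/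
theorem abs_sum_log_pow_mul_sub_le (c : ℕ → ℝ) {B : ℝ} (hc0 : c 0 = 0)
    (hS : ∀ t : ℝ, 1 ≤ t → |∑ k ∈ Icc 0 ⌊t⌋₊, c k - Real.log t| ≤ B)
    (j : ℕ) {x : ℝ} (hx : 1 ≤ x) :
    |∑ k ∈ Icc 0 ⌊x⌋₊, Real.log k ^ j * c k - Real.log x ^ (j + 1) / (j + 1)|
      ≤ 2 * B * Real.log x ^ j := by
  have hB : 0 ≤ B := (abs_nonneg _).trans (hS 1 le_rfl)
  set f : ℝ → ℝ := fun u => Real.log u ^ j with hf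
  set g : ℝ → ℝ := fun t => (j : ℝ) * Real.log t ^ (j - 1) * t⁻¹ with hg
  set S : ℝ → ℝ := fun t => ∑ k ∈ Icc 0 ⌊t⌋₊, c k with hSdef
  have hY0 : 0 ≤ Real.log x := Real.log_nonneg hx
  have hmem : ∀ t ∈ Set.Icc 1 x, t ∈ ({0}ᶜ : Set ℝ) := fun t ht =>
    Set.mem_compl_singleton_iff.mpr (show (0 : ℝ) < t by linarith [ht.1]).ne'
  have hderiv : ∀ t : ℝ, 0 < t → HasDerivAt f (g t) t := fun t ht =>
    hasDerivAt_log_pow j ht.ne'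
  have hf_diff : ∀ t ∈ Set.Icc 1 x, DifferentiableAt ℝ f t := fun t ht =>
    (hderiv t (by linarith [ht.1])).differentiableAt
  have hgcont : ContinuousOn g (Set.Icc 1 x) :=
    ((continuousOn_const.mul ((Real.continuousOn_log.mono hmem).pow _)).mul
      (continuousOn_inv₀.mono hmem))
  have hderiv_eq : Set.EqOn g (deriv f) (Set.Icc 1 x) := fun t ht =>
    ((hderiv t (by linarith [ht.1])).deriv).symm
  have hg_int : IntegrableOn g (Set.Icc 1 x) := hgcont.integrableOn_Icc
  have hf_int : IntegrableOn (deriv f) (Set.Icc 1 x) :=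
    hg_int.congr_fun hderiv_eq measurableSet_Icc
  have habel := sum_mul_eq_sub_integral_mul₀ c hc0 x hf_diff hf_int
  -- the integral term, rewritten with `g`
  have hI : ∫ t in Set.Ioc 1 x, deriv f t * S t = ∫ t in Set.Ioc 1 x, g t * S t :=
    setIntegral_congr_fun measurableSet_Ioc fun t ht ↦ by
      rw [← hderiv_eq (Set.Ioc_subset_Icc_self ht)]
  -- integrability on `Ioc 1 x`
  have hgS_int : IntegrableOn (fun t => g t * S t) (Set.Ioc 1 x) :=
    (integrableOn_mul_sum_Icc c zero_le_one hg_int).mono_set Set.Ioc_subset_Icc_self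
  have hglog_cont : ContinuousOn (fun t => g t * Real.log t) (Set.Icc 1 x) :=
    hgcont.mul (Real.continuousOn_log.mono hmem)
  have hglog_int : IntegrableOn (fun t => g t * Real.log t) (Set.Ioc 1 x) :=
    hglog_cont.integrableOn_Icc.mono_set Set.Ioc_subset_Icc_self
  have hg_int' : IntegrableOn g (Set.Ioc 1 x) := hg_int.mono_set Set.Ioc_subset_Icc_self
  -- `g ≥ 0` on `[1, x]`
  have hg_nonneg : ∀ t : ℝ, 1 ≤ t → 0 ≤ g t := fun t ht => by
    have : 0 ≤ Real.log t := Real.log_nonneg ht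
    simp only [hg]
    positivity
  -- the two exact integrals (FTC)
  have hI1 : ∫ t in Set.Ioc 1 x, g t * Real.log t = (j : ℝ) / (j + 1) * Real.log x ^ (j + 1) := by
    rw [← intervalIntegral.integral_of_le hx]
    have hd : ∀ t ∈ Set.uIcc 1 x,
        HasDerivAt (fun u : ℝ => (j : ℝ) / (j + 1) * Real.log u ^ (j + 1)) (g t * Real.log t) t := by
      intro t ht
      rw [Set.uIcc_of_le hx] at ht
      exact hasDerivAt_log_pow_succ j (by linarith [ht.1])
    rw [intervalIntegral.integral_eq_sub_of_hasDerivAt hd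
      ((hglog_cont.mono (by rw [Set.uIcc_of_le hx])).intervalIntegrable)]
    simp
  have hI2 : ∫ t in Set.Ioc 1 x, g t = Real.log x ^ j - 0 ^ j := by
    rw [← intervalIntegral.integral_of_le hx]
    have hd : ∀ t ∈ Set.uIcc 1 x, HasDerivAt f (g t) t := by
      intro t ht
      rw [Set.uIcc_of_le hx] at ht
      exact hderiv t (by linarith [ht.1])
    rw [intervalIntegral.integral_eq_sub_of_hasDerivAt hd
      ((hgcont.mono (by rw [Set.uIcc_of_le hx])).intervalIntegrable)]
    simp [hf]
  have hI2le : ∫ t in Set.Ioc 1 x, g t ≤ Real.log x ^ j := by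
    rw [hI2]
    linarith [pow_nonneg (le_refl (0 : ℝ)) j]
  -- the error in the integral term
  have hE : |(∫ t in Set.Ioc 1 x, g t * S t) - ∫ t in Set.Ioc 1 x, g t * Real.log t|
      ≤ B * Real.log x ^ j := by
    rw [← integral_sub hgS_int hglog_int]
    calc |∫ t in Set.Ioc 1 x, (g t * S t - g t * Real.log t)|
        ≤ ∫ t in Set.Ioc 1 x, |g t * S t - g t * Real.log t| := abs_integral_le_integral_abs
      _ ≤ ∫ t in Set.Ioc 1 x, B * g t := by
          refine setIntegral_mono_on (hgS_int.sub hglog_int).abs (hg_int'.const_mul B)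
            measurableSet_Ioc fun t ht ↦ ?_
          have ht1 : 1 ≤ t := ht.1.le
          rw [← mul_sub, abs_mul, abs_of_nonneg (hg_nonneg t ht1), mul_comm]
          exact mul_le_mul_of_nonneg_right (hS t ht1) (hg_nonneg t ht1)
      _ = B * ∫ t in Set.Ioc 1 x, g t := integral_const_mul _ _
      _ ≤ B * Real.log x ^ j := mul_le_mul_of_nonneg_left hI2le hB
  -- the boundary term
  have hbd : |f x * S x - Real.log x ^ (j + 1)| ≤ B * Real.log x ^ j := by
    have e : f x * S x - Real.log x ^ (j + 1) = Real.log x ^ j * (S x - Real.log x) := by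
      simp only [hf]; ring
    rw [e, abs_mul, abs_of_nonneg (pow_nonneg hY0 j), mul_comm]
    exact mul_le_mul_of_nonneg_right (hS x hx) (pow_nonneg hY0 j)
  -- assemble
  have hsum : ∑ k ∈ Icc 0 ⌊x⌋₊, Real.log k ^ j * c k = f x * S x - ∫ t in Set.Ioc 1 x, g t * S t := by
    rw [← hI]; exact habel
  rw [hsum]
  have key : f x * S x - (∫ t in Set.Ioc 1 x, g t * S t) - Real.log x ^ (j + 1) / (j + 1)
      = (f x * S x - Real.log x ^ (j + 1))
        - ((∫ t in Set.Ioc 1 x, g t * S t) - ∫ t in Set.Ioc 1 x, g t * Real.log t) := by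
    rw [hI1]
    have hj : ((j : ℝ) + 1) ≠ 0 := by positivity
    field_simp
    ring
  rw [key]
  calc |(f x * S x - Real.log x ^ (j + 1))
        - ((∫ t in Set.Ioc 1 x, g t * S t) - ∫ t in Set.Ioc 1 x, g t * Real.log t)|
      ≤ |f x * S x - Real.log x ^ (j + 1)|
        + |(∫ t in Set.Ioc 1 x, g t * S t) - ∫ t in Set.Ioc 1 x, g t * Real.log t| := abs_sub _ _
    _ ≤ B * Real.log x ^ j + B * Real.log x ^ j := add_le_add hbd hE
    _ = 2 * B * Real.log x ^ j := by ring


/-! ### §2. The two instances: harmonic weights (A1) and Chebyshev weights on primes (A2) -/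

/-- Dropping the vanishing `k = 0` term: `Σ_{k ∈ [0,n]} F k = Σ_{k ∈ [1,n]} F k` when `F 0 = 0`.
[folklore] -/
private theorem sum_Icc_zero_eq_sum_Icc_one {M : Type*} [AddCommMonoid M] (F : ℕ → M) (h0 : F 0 = 0)
    (n : ℕ) : ∑ k ∈ Icc 0 n, F k = ∑ k ∈ Icc 1 n, F k := by
  rw [Icc_eq_cons_Ioc (Nat.zero_le n), sum_cons, h0, zero_add]
  rfl

/-- The harmonic counting function is `log t + O(1)`: `|Σ_{1 ≤ k ≤ t} 1/k − log t| ≤ 1` for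
`t ≥ 1` (Apostol Thm 3.2(a) `Σ_{n ≤ x} 1/n = log x + C + O(1/x)` in the explicit two-sided form of
Mathlib's `log_le_harmonic_floor` / `harmonic_floor_le_one_add_log`). [cite: Apostol1976, Thm 3.2(a)] -/
theorem abs_harmonic_floor_sub_log_le {t : ℝ} (ht : 1 ≤ t) :
    |∑ k ∈ Icc 0 ⌊t⌋₊, (k : ℝ)⁻¹ - Real.log t| ≤ 1 := by
  have hH : ∑ k ∈ Icc 0 ⌊t⌋₊, (k : ℝ)⁻¹ = (harmonic ⌊t⌋₊ : ℝ) := by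
    rw [sum_Icc_zero_eq_sum_Icc_one (fun k : ℕ => (k : ℝ)⁻¹) (by simp), harmonic_eq_sum_Icc]
    push_cast
    rfl
  rw [hH, abs_le]
  constructor
  · linarith [log_le_harmonic_floor t (by linarith)]
  · linarith [harmonic_floor_le_one_add_log t ht]

/-- **(A1) log-power harmonic sums**: for `x ≥ 1` and every `j : ℕ`,
`|Σ_{m ≤ x} (log m)^j/m − (log x)^{j+1}/(j+1)| ≤ 2 (log x)^j` (Abel's identity against the
harmonic counting function). [cite: Apostol1976, Thm 3.2(a) with Thm 4.2] -/
theorem abs_sum_log_pow_div_sub_le (j : ℕ) {x : ℝ} (hx : 1 ≤ x) :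
    |∑ m ∈ Icc 1 ⌊x⌋₊, Real.log m ^ j / m - Real.log x ^ (j + 1) / (j + 1)|
      ≤ 2 * Real.log x ^ j := by
  have h := abs_sum_log_pow_mul_sub_le (fun k : ℕ => (k : ℝ)⁻¹) (by simp)
    (fun t ht => abs_harmonic_floor_sub_log_le ht) j hx
  rw [sum_Icc_zero_eq_sum_Icc_one _ (by simp)] at h
  simpa [div_eq_mul_inv] using h

/-- **(A2) prime log-moments**: for `y ≥ 1` and every `j : ℕ`,
`|Σ_{p ≤ y} (log p/p)(log p)^j − (log y)^{j+1}/(j+1)| ≤ 8 (log y)^j`, from the tree's two-sided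
Mertens-I `|Σ_{p ≤ t} log p/p − log t| ≤ 4` (`Mertens.abs_mertensTau_le`) by Abel's identity.
[cite: Apostol1976, Thm 4.10 with Thm 4.2; HardyWright2008, Thm 425 (§22.6)] -/
theorem abs_sum_primesLE_logDiv_mul_log_pow_sub_le (j : ℕ) {y : ℝ} (hy : 1 ≤ y) :
    |∑ p ∈ Nat.primesLE ⌊y⌋₊, Real.log p / p * Real.log p ^ j - Real.log y ^ (j + 1) / (j + 1)|
      ≤ 8 * Real.log y ^ j := by
  set c : ℕ → ℝ := fun k => if k.Prime then Real.log k / k else 0 with hc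
  have hc0 : c 0 = 0 := by simp [hc, Nat.not_prime_zero]
  have hS : ∀ t : ℝ, 1 ≤ t → |∑ k ∈ Icc 0 ⌊t⌋₊, c k - Real.log t| ≤ 4 := by
    intro t ht
    have h1 : ∑ k ∈ Icc 0 ⌊t⌋₊, c k = Mertens.primeLogDivSum t := by
      rw [hc, Literature.NumberTheory.LFunctions.MertensBound.sum_Icc_ite_prime_log_div]; rfl
    rw [h1]
    exact Mertens.abs_mertensTau_le ht
  have h := abs_sum_log_pow_mul_sub_le c hc0 hS j hy
  have hsum : ∑ k ∈ Icc 0 ⌊y⌋₊, Real.log k ^ j * c k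
      = ∑ p ∈ Nat.primesLE ⌊y⌋₊, Real.log p / p * Real.log p ^ j := by
    rw [Nat.primesLE_eq_filter_range, Finset.sum_filter, Nat.range_succ_eq_Icc_zero]
    refine Finset.sum_congr rfl fun k _ => ?_
    simp only [hc, mul_ite, mul_zero]
    split_ifs <;> ring
  rw [hsum] at h
  linarith

/-- **(A2) normalised, UNIFORM in `j`**: for `y > 1` and every `j : ℕ`,
`|Σ_{p ≤ y} (log p/p)(log p/log y)^j − log y/(j+1)| ≤ 8`.
[cite: Apostol1976, Thm 4.10 with Thm 4.2; HardyWright2008, Thm 425 (§22.6)] -/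
theorem abs_sum_primesLE_logDiv_mul_pow_sub_le (j : ℕ) {y : ℝ} (hy : 1 < y) :
    |∑ p ∈ Nat.primesLE ⌊y⌋₊, Real.log p / p * (Real.log p / Real.log y) ^ j
        - Real.log y / (j + 1)| ≤ 8 := by
  have hY : 0 < Real.log y := Real.log_pos hy
  have hYj : 0 < Real.log y ^ j := pow_pos hY j
  have h := abs_sum_primesLE_logDiv_mul_log_pow_sub_le j hy.le
  have e : ∑ p ∈ Nat.primesLE ⌊y⌋₊, Real.log p / p * (Real.log p / Real.log y) ^ j
        - Real.log y / (j + 1)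
      = (∑ p ∈ Nat.primesLE ⌊y⌋₊, Real.log p / p * Real.log p ^ j
          - Real.log y ^ (j + 1) / (j + 1)) / Real.log y ^ j := by
    rw [sub_div, Finset.sum_div]
    congr 1
    · refine Finset.sum_congr rfl fun p _ => ?_
      rw [div_pow, mul_div_assoc]
    · have hj : ((j : ℝ) + 1) ≠ 0 := by positivity
      field_simp
      ring
  rw [e, abs_div, abs_of_pos hYj, div_le_iff₀ hYj]
  exact h

/-! ### §3. (A3) the prime-power tail of `Σ Λ(k)/k` -/

/-- The prime part of `Σ_{k ≤ n} Λ(k)/k` is `Σ_{p ≤ n} log p/p`. [folklore] -/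
private theorem sum_filter_prime_vonMangoldt_div (n : ℕ) :
    ∑ k ∈ (Finset.Icc 1 n).filter (fun k => k.Prime), Λ k / k
      = ∑ p ∈ Nat.primesLE n, Real.log p / p := by
  have hset : (Finset.Icc 1 n).filter (fun k => k.Prime) = Nat.primesLE n := by
    ext k
    rw [Finset.mem_filter, Finset.mem_Icc, Nat.mem_primesLE]
    constructor
    · rintro ⟨⟨-, hk⟩, hp⟩; exact ⟨hk, hp⟩
    · rintro ⟨hk, hp⟩; exact ⟨⟨hp.one_lt.le, hk⟩, hp⟩
  rw [hset]
  refine Finset.sum_congr rfl fun p hp => ?_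
  rw [ArithmeticFunction.vonMangoldt_apply_prime (Nat.mem_primesLE.mp hp).2]

/-- **(A3) prime-power tail**: for `x ≥ 1`, `Σ_{k ≤ x, k not prime} Λ(k)/k ≤ 39/50 + 4` — the
difference of the tree's `Σ_{k ≤ x} Λ(k)/k ≤ log x + 39/50`
(`MertensFirstUpper.sum_vonMangoldt_div_floor_le_log_add`) and `Σ_{p ≤ x} log p/p ≥ log x − 4`
(`MertensBound.sum_log_div_prime_bounds`); this is the bounded prime-power double sum
`Σ_p Σ_{m ≥ 2} log p/p^m` of Apostol's proof of Thm 4.10, with the tree's constants.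
[cite: Apostol1976, Thm 4.9–4.10 (proof of Thm 4.10); HardyWright2008, Thm 424–425 (§22.5–22.6)] -/
theorem sum_vonMangoldt_div_not_prime_le {x : ℝ} (hx : 1 ≤ x) :
    ∑ k ∈ (Finset.Icc 1 ⌊x⌋₊).filter (fun k => ¬ k.Prime), Λ k / k ≤ 39 / 50 + 4 := by
  have htot := MertensFirstUpper.sum_vonMangoldt_div_floor_le_log_add hx
  have hI : Finset.Ioc 0 ⌊x⌋₊ = Finset.Icc 1 ⌊x⌋₊ := rfl
  rw [hI, ← Finset.sum_filter_add_sum_filter_not (Icc 1 ⌊x⌋₊) (fun k => k.Prime),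
    sum_filter_prime_vonMangoldt_div] at htot
  have hprime := (Literature.NumberTheory.LFunctions.MertensBound.sum_log_div_prime_bounds hx).1
  linarith

end MO84

end Literature.NumberTheory.LFunctions

end
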